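import Summits.QuantumFields.YangMills.Theorems.BalabanUVNodesN19SharpPrice
import Summits.QuantumFields.YangMills.Theorems.BalabanUVNodesN19NoLinearPrice

/-!
# YM-DAG node N19 (= NE7 proper) — THE PRICE OF THE EXPECTATION CURRENCY IS EXACTLY `ε·log ε⁻¹ ∕ log log ε⁻¹`, II: the grid witnesses attain
# the sibling's upper bound — ★★ `sharp_price_two_sided`

Cell `pub-ymgap`, HUMAN RULING D-0062 (Track A), R141 (C) wider-strategy seat `pub-ymgap-dag-n19-e` (strategy s3 = ALTERNATIVE CURRENCY), generation
g13, module 2 of 2 (sibling `…Theorems.BalabanUVNodesN19SharpPrice` filed right before: ★★ `abs_integral_sub_integral_le_sharp_of_cgf_close`,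
`|∫Y dν − ∫X dμ| ≤ 4e^{1+e·l₀B}·ε·(1 + log⁺ ε⁻¹)∕(l₀·log(e + log⁺ ε⁻¹))` for `[−B, B]`-valued observables with cgf's `ε`-close on `|t| ≤ l₀`).  Route
`Summits/QuantumFields/YangMills/Theses/BalabanUVNodes.lean` rev 19, cluster item K3⁗ «SpineGivenEndpointR13Sep» (stmt-QuantumFields-20292); filed
`--supports` that item `--as helper` (it proves no registered stub).  COUNT-NEUTRAL: elementary real analysis over Mathlib on top of p510514
`…N19NoLinearPrice` (`exists_cgf_close_means_far`: for odd `M` two probability laws on `[0, 1]` with cgf's `ε`-close on `|t| ≤ l₀`,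
`e^{l₀}·2(1 + 4M∕l₀)^{−M} ≤ ε ≤ e^{l₀}·4(l₀e^{l₀}∕(2M))^M`, `|ΔE| ≥ (Me^{−2l₀}∕l₀)·ε`), the sibling, and the tree's
`T4GenFunBounds.differentiable_cgf_of_abs_le` (§2′); NOT a discharge claim.

THE RESULT.  §2′ `cgf_close_closedWindow_of_openWindow` ∕ `abs_integral_sub_integral_le_sharp_of_cgf_close_openWindow`: the sibling's sharp price under
p480837's hypotheses VERBATIM (open window `|t| < l₀`; cgf's of bounded observables are continuous, so closeness passes to the closed window).  With
`P(ε) = ε·(1 + log⁺ ε⁻¹)∕log(e + log⁺ ε⁻¹)`: §3 `one_add_le_mul_log_of_le` — `L ≤ M·log(1 + 4M∕l₀)` forces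
`1 + L ≤ (4 + log(1 + 4∕l₀))·M·log(e + L)` (case `L ≤ eM`: `1 + L ≤ 4M`; case `L > eM`: `log(e + L) ≥ 1 + log M`, `log(1 + 4M∕l₀) ≤ log M + log(1 + 4∕l₀)`);
`exists_cgf_close_means_far_sharp` — p510514's pair at odd `M` has `|ΔE| ≥ c(l₀)·P(ε)`, `c(l₀) = e^{−2l₀}∕(l₀·(4 + log(1 + 4∕l₀)))`, uniformly in `M`;
★★ `sharp_price_two_sided` — for every window `0 < l₀` and every `ε₀ > 0` there are two probability laws on `[0, 1]` and `0 < ε ≤ ε₀` with cgf's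
`ε`-close on `|t| ≤ l₀` and `c(l₀)·P(ε) ≤ |E_ν − E_μ| ≤ C(l₀)·P(ε)`, `C(l₀) = 4e^{1+e·l₀}∕l₀` (the upper half = the sibling's theorem at `X = Y = id`, `B = 1`,
valid for EVERY such pair).  This closes «WHAT STAYS OPEN» of `…N19NoLinearPriceSharp` (p511222): there is no `log log` gap and no family without the
`log log`; the grid-Chebyshev witnesses of p509390 ∕ p510514 are extremal up to an `l₀`-constant.

HONEST FRAMING (binding).  Elementary; NO consumer in the DAG today (the apex consumes existence of limits, not rates); value = optimality certificate
(two-sided) for the lineage's rate theorems p480837 ∕ p481156 ∕ p482030 and the sibling.  Nothing of [Balaban1987RG1]–[Balaban1989LargeFieldII] or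
[King1986] is instantiated; NE7 ∕ NE7b ∕ NE7c NOT PRINTED, NOT proved; N19 NOT discharged; Track A count unmoved (typed 28∕28 · discharged 5∕27 · A 5∕28).
One finite `T⁴` programme at fixed `ε`; nothing continuum ∕ `ℝ⁴` ∕ OS ∕ mass-gap ∕ Clay.  THEOREMS ONLY (5); 0 `def`; 0 `sorry`; standard axioms.
-/

set_option autoImplicit false

noncomputable section

open Set Filter Topology MeasureTheory ProbabilityTheory
open scoped BigOperators

namespace Summit.QuantumFields.YangMills.Theorems.BalabanUVNodesN19SharpPriceTwoSided

open Summit.QuantumFields.YangMills.Theorems.BalabanUVNodesN19SharpPrice (abs_integral_sub_integral_le_sharp_of_cgf_close)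
open Summit.QuantumFields.YangMills.Theorems.BalabanUVNodesN19NoLinearPrice (exists_cgf_close_means_far ae_abs_le_one_of_Icc)

/-! ## §2′ The open window: the sibling's sharp price under p480837's hypotheses verbatim [folklore] -/

section OpenWindow

open Literature.MathematicalPhysics.QuantumFieldTheory.Balaban1983to89

variable {Ω Ω' : Type*} [MeasurableSpace Ω] [MeasurableSpace Ω'] {μ : Measure Ω} {ν : Measure Ω'}
  [IsProbabilityMeasure μ] [IsProbabilityMeasure ν] {X : Ω → ℝ} {Y : Ω' → ℝ} {B : ℝ}

/-- Closeness of the cgf's of two a.e.-bounded observables on the OPEN window `|t| < l₀` extends to the CLOSED window `|t| ≤ l₀`: both cgf's are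
continuous (`T4GenFunBounds.differentiable_cgf_of_abs_le`) and a closed condition valid on `Ioo (−l₀) l₀` holds on its closure `Icc (−l₀) l₀`. [folklore] -/
theorem cgf_close_closedWindow_of_openWindow (hX : AEMeasurable X μ) (hY : AEMeasurable Y ν)
    (hXB : ∀ᵐ ω ∂μ, |X ω| ≤ B) (hYB : ∀ᵐ ω ∂ν, |Y ω| ≤ B) {ε l₀ : ℝ} (hl₀ : 0 < l₀)
    (hε : ∀ t : ℝ, |t| < l₀ → |cgf Y ν t - cgf X μ t| ≤ ε) (t : ℝ) (ht : |t| ≤ l₀) :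
    |cgf Y ν t - cgf X μ t| ≤ ε := by
  have hc : Continuous fun s => |cgf Y ν s - cgf X μ s| :=
    ((T4GenFunBounds.differentiable_cgf_of_abs_le hY hYB).continuous.sub
      (T4GenFunBounds.differentiable_cgf_of_abs_le hX hXB).continuous).abs
  have hclosed : IsClosed {s : ℝ | |cgf Y ν s - cgf X μ s| ≤ ε} := isClosed_le hc continuous_const
  have hsub : Set.Ioo (-l₀) l₀ ⊆ {s : ℝ | |cgf Y ν s - cgf X μ s| ≤ ε} := fun s hs => hε s (abs_lt.2 hs)
  have hcl : closure (Set.Ioo (-l₀) l₀) ⊆ {s : ℝ | |cgf Y ν s - cgf X μ s| ≤ ε} :=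
    hclosed.closure_subset_iff.2 hsub
  rw [closure_Ioo (by linarith : (-l₀) ≠ l₀)] at hcl
  exact hcl (Set.mem_Icc.2 (abs_le.1 ht))

/-- **THE SHARP PRICE UNDER p480837's HYPOTHESES VERBATIM.**  Two probability spaces, observables `|X|, |Y| ≤ B` a.e., cgf's `ε`-close on the OPEN
window `|t| < l₀` (`0 < l₀`, `0 ≤ ε`) — exactly the hypotheses of `N19ExpectationCurrencyTwoConstants.abs_integral_sub_integral_le_linlog_of_cgf_close` —
give the sibling's conclusion `|∫ Y dν − ∫ X dμ| ≤ 4e^{1+e·l₀B}·ε·(1 + log⁺ ε⁻¹)∕(l₀·log(e + log⁺ ε⁻¹))`: p480837's theorem with its `(1 + log⁺ ε⁻¹)∕l₀`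
replaced by `e^{(e−1)l₀B}·(1 + log⁺ ε⁻¹)∕(l₀·log(e + log⁺ ε⁻¹))`. [folklore] -/
theorem abs_integral_sub_integral_le_sharp_of_cgf_close_openWindow (hX : AEMeasurable X μ) (hY : AEMeasurable Y ν)
    (hXB : ∀ᵐ ω ∂μ, |X ω| ≤ B) (hYB : ∀ᵐ ω ∂ν, |Y ω| ≤ B) {ε l₀ : ℝ} (hl₀ : 0 < l₀) (hε0 : 0 ≤ ε)
    (hε : ∀ t : ℝ, |t| < l₀ → |cgf Y ν t - cgf X μ t| ≤ ε) :
    |∫ ω, Y ω ∂ν - ∫ ω, X ω ∂μ| ≤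
      4 * Real.exp (1 + Real.exp 1 * l₀ * B) * ε * (1 + Real.posLog ε⁻¹) /
        (l₀ * Real.log (Real.exp 1 + Real.posLog ε⁻¹)) :=
  abs_integral_sub_integral_le_sharp_of_cgf_close hX hY hXB hYB hl₀ hε0
    (cgf_close_closedWindow_of_openWindow hX hY hXB hYB hl₀ hε)

end OpenWindow

/-! ## §3 Sharpness: the grid witnesses attain the order `ε·log ε⁻¹ ∕ log log ε⁻¹` [folklore] -/

section Sharp

open Real

/-- Arithmetic of the witnesses: if `L ≤ M·log(1 + 4M∕l₀)` (`1 ≤ M`, `0 ≤ L`, `0 < l₀`) then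
`1 + L ≤ (4 + log(1 + 4∕l₀))·M·log(e + L)` (case `L ≤ eM`: `1 + L ≤ 4M`; case `L > eM`: `log(e + L) ≥ 1 + log M` and
`log(1 + 4M∕l₀) ≤ log M + log(1 + 4∕l₀)`). [folklore] -/
theorem one_add_le_mul_log_of_le {l₀ L : ℝ} {M : ℕ} (hl₀ : 0 < l₀) (hM : 1 ≤ M) (hL0 : 0 ≤ L)
    (hL : L ≤ M * Real.log (1 + 4 * M / l₀)) :
    1 + L ≤ (4 + Real.log (1 + 4 / l₀)) * M * Real.log (Real.exp 1 + L) := by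
  have hM1 : (1 : ℝ) ≤ M := by exact_mod_cast hM
  have hM0 : (0 : ℝ) < M := one_pos.trans_le hM1
  have h4l : 0 < 4 / l₀ := div_pos four_pos hl₀
  have hc0 : 0 ≤ Real.log (1 + 4 / l₀) := Real.log_nonneg (by linarith)
  have heL : 0 < Real.exp 1 + L := by positivity
  have hlog1 : 1 ≤ Real.log (Real.exp 1 + L) := by
    rw [Real.le_log_iff_exp_le heL]
    linarith
  have he3 : Real.exp 1 ≤ 3 := by linarith [Real.exp_one_lt_d9]
  rcases le_or_gt L (Real.exp 1 * M) with h | h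
  · calc 1 + L ≤ 1 + Real.exp 1 * M := by linarith
      _ ≤ 4 * M := by nlinarith
      _ ≤ 4 * M * Real.log (Real.exp 1 + L) := le_mul_of_one_le_right (by positivity) hlog1
      _ ≤ (4 + Real.log (1 + 4 / l₀)) * M * Real.log (Real.exp 1 + L) := by
          gcongr
          linarith
  · have hLpos : 0 < L := lt_of_le_of_lt (by positivity) h
    have hlogL : 1 + Real.log M ≤ Real.log (Real.exp 1 + L) :=
      calc 1 + Real.log M = Real.log (Real.exp 1 * M) := by
            rw [Real.log_mul (Real.exp_pos 1).ne' hM0.ne', Real.log_exp]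
        _ ≤ Real.log L := Real.log_le_log (by positivity) h.le
        _ ≤ Real.log (Real.exp 1 + L) := Real.log_le_log hLpos (by linarith [Real.exp_pos 1])
    have hA : Real.log (1 + 4 * M / l₀) ≤ Real.log M + Real.log (1 + 4 / l₀) := by
      rw [← Real.log_mul hM0.ne' (by linarith)]
      refine Real.log_le_log (by positivity) ?_
      have e : (M : ℝ) * (1 + 4 / l₀) = M + 4 * M / l₀ := by ring
      rw [e]
      linarith
    have hlogM : 0 ≤ Real.log M := Real.log_nonneg hM1
    calc 1 + L ≤ 1 + M * (Real.log M + Real.log (1 + 4 / l₀)) := by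
          have := mul_le_mul_of_nonneg_left hA hM0.le
          linarith
      _ ≤ M * (1 + Real.log M) + M * Real.log (1 + 4 / l₀) * 1 := by nlinarith
      _ ≤ M * (Real.log (Real.exp 1 + L) * 4) + M * Real.log (1 + 4 / l₀) * Real.log (Real.exp 1 + L) :=
          add_le_add (mul_le_mul_of_nonneg_left (hlogL.trans (by linarith)) hM0.le)
            (mul_le_mul_of_nonneg_left hlog1 (by positivity))
      _ = (4 + Real.log (1 + 4 / l₀)) * M * Real.log (Real.exp 1 + L) := by ring

/-- **CGF's CLOSE ON THE WINDOW, MEANS `c(l₀)·P(ε)` APART (explicit family).**  For every window `0 < l₀` and every odd `M`, p510514's pair of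
probability laws on `[0, 1]` (`exists_cgf_close_means_far`) has cgf's `ε`-close on `|t| ≤ l₀` with `0 < ε ≤ e^{l₀}·4·(l₀e^{l₀}∕(2M))^M` and
`|E_ν − E_μ| ≥ c(l₀)·ε·(1 + log⁺ ε⁻¹)∕log(e + log⁺ ε⁻¹)`, `c(l₀) = e^{−2l₀}∕(l₀·(4 + log(1 + 4∕l₀)))` — from `|ΔE| ≥ (Me^{−2l₀}∕l₀)·ε`,
`log⁺ ε⁻¹ ≤ M·log(1 + 4M∕l₀)` (the lower bound `ε ≥ e^{l₀}·2(1 + 4M∕l₀)^{−M}`) and `one_add_le_mul_log_of_le`. [folklore] -/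
theorem exists_cgf_close_means_far_sharp {l₀ : ℝ} (hl₀ : 0 < l₀) {M : ℕ} (hM : Odd M) :
    ∃ μ ν : Measure ℝ, IsProbabilityMeasure μ ∧ IsProbabilityMeasure ν ∧
      μ (Set.Icc 0 1)ᶜ = 0 ∧ ν (Set.Icc 0 1)ᶜ = 0 ∧
      ∃ ε : ℝ, 0 < ε ∧ ε ≤ Real.exp l₀ * (4 * (l₀ * Real.exp l₀ / (2 * M)) ^ M) ∧
        (∀ t : ℝ, |t| ≤ l₀ → |cgf id ν t - cgf id μ t| ≤ ε) ∧
        Real.exp (-2 * l₀) / (l₀ * (4 + Real.log (1 + 4 / l₀))) *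
            (ε * (1 + Real.posLog ε⁻¹) / Real.log (Real.exp 1 + Real.posLog ε⁻¹)) ≤
          |∫ x, x ∂ν - ∫ x, x ∂μ| := by
  obtain ⟨μ, ν, iμ, iν, hμ, hν, ε, hε, hlo, hhi, hwin, hmom⟩ := exists_cgf_close_means_far hl₀ hM
  refine ⟨μ, ν, iμ, iν, hμ, hν, ε, hε, hhi, hwin, ?_⟩
  have hM1 : 1 ≤ M := hM.pos
  have hM0 : (0 : ℝ) < M := by exact_mod_cast hM.pos
  set L := Real.posLog ε⁻¹ with hL
  have hL0 : 0 ≤ L := Real.posLog_nonneg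
  -- `L ≤ M·log(1 + 4M/l₀)` from the lower bound on `ε`
  have hbase : 1 ≤ 1 + 4 * (M : ℝ) / l₀ := by
    have : 0 ≤ 4 * (M : ℝ) / l₀ := by positivity
    linarith
  have hpow1 : 1 ≤ (1 + 4 * (M : ℝ) / l₀) ^ M := one_le_pow₀ hbase
  have hinv : ε⁻¹ ≤ (1 + 4 * (M : ℝ) / l₀) ^ M := by
    rw [inv_le_comm₀ hε (by positivity)]
    calc ((1 + 4 * (M : ℝ) / l₀) ^ M)⁻¹ = 1 * (1 / (1 + 4 * (M : ℝ) / l₀) ^ M) := by rw [one_mul, one_div]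
      _ ≤ Real.exp l₀ * (2 / (1 + 4 * (M : ℝ) / l₀) ^ M) := by
          gcongr
          · exact Real.one_le_exp hl₀.le
          · norm_num
      _ ≤ ε := hlo
  have hLle : L ≤ M * Real.log (1 + 4 * M / l₀) := by
    calc L = Real.posLog ε⁻¹ := hL
      _ ≤ Real.posLog ((1 + 4 * (M : ℝ) / l₀) ^ M) :=
          Real.monotoneOn_posLog (Set.mem_Ici.2 (inv_nonneg.2 hε.le)) (Set.mem_Ici.2 (by positivity)) hinv
      _ = Real.log ((1 + 4 * (M : ℝ) / l₀) ^ M) :=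
          Real.posLog_eq_log (by rwa [abs_of_nonneg (by positivity)])
      _ = M * Real.log (1 + 4 * M / l₀) := by rw [Real.log_pow]
  have harith := one_add_le_mul_log_of_le hl₀ hM1 hL0 hLle
  have hc : 0 < 4 + Real.log (1 + 4 / l₀) := by
    have : 0 ≤ Real.log (1 + 4 / l₀) := Real.log_nonneg (by linarith [div_pos four_pos hl₀])
    linarith
  have hlogpos : 0 < Real.log (Real.exp 1 + L) := by
    have : 1 ≤ Real.log (Real.exp 1 + L) := by
      rw [Real.le_log_iff_exp_le (by positivity)]
      linarith
    linarith
  generalize hcdef : 4 + Real.log (1 + 4 / l₀) = c at hc harith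
  generalize hgdef : Real.log (Real.exp 1 + L) = g at hlogpos harith
  calc Real.exp (-2 * l₀) / (l₀ * c) * (ε * (1 + L) / g)
      ≤ Real.exp (-2 * l₀) / (l₀ * c) * (ε * (c * M * g) / g) := by gcongr
    _ = M * Real.exp (-2 * l₀) / l₀ * ε := by
        field_simp
    _ ≤ |∫ x, x ∂ν - ∫ x, x ∂μ| := hmom

/-- **★★ THE PRICE OF THE EXPECTATION CURRENCY IS EXACTLY `P(ε) = ε·(1 + log⁺ ε⁻¹)∕log(e + log⁺ ε⁻¹)` (two-sided, arbitrarily small `ε`).**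
For every window `0 < l₀` and every `ε₀ > 0` there are two probability laws `μ, ν` on `[0, 1]` and `0 < ε ≤ ε₀` with cgf's `ε`-close on
`|t| ≤ l₀` and `c(l₀)·P(ε) ≤ |E_ν − E_μ| ≤ C(l₀)·P(ε)`, `c(l₀) = e^{−2l₀}∕(l₀·(4 + log(1 + 4∕l₀)))`, `C(l₀) = 4e^{1+e·l₀}∕l₀` — the lower half is
`exists_cgf_close_means_far_sharp` at a large odd `M`, the upper half is §2's theorem (`X = Y = id`, `B = 1`), valid for EVERY such pair.
Closes «WHAT STAYS OPEN» of `…N19NoLinearPriceSharp`: there is no `log log` gap and no family without the `log log`. [folklore] -/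
theorem sharp_price_two_sided {l₀ : ℝ} (hl₀ : 0 < l₀) {ε₀ : ℝ} (hε₀ : 0 < ε₀) :
    ∃ μ ν : Measure ℝ, IsProbabilityMeasure μ ∧ IsProbabilityMeasure ν ∧
      μ (Set.Icc 0 1)ᶜ = 0 ∧ ν (Set.Icc 0 1)ᶜ = 0 ∧
      ∃ ε : ℝ, 0 < ε ∧ ε ≤ ε₀ ∧ (∀ t : ℝ, |t| ≤ l₀ → |cgf id ν t - cgf id μ t| ≤ ε) ∧
        Real.exp (-2 * l₀) / (l₀ * (4 + Real.log (1 + 4 / l₀))) *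
            (ε * (1 + Real.posLog ε⁻¹) / Real.log (Real.exp 1 + Real.posLog ε⁻¹)) ≤ |∫ x, x ∂ν - ∫ x, x ∂μ| ∧
        |∫ x, x ∂ν - ∫ x, x ∂μ| ≤
          4 * Real.exp (1 + Real.exp 1 * l₀) / l₀ * (ε * (1 + Real.posLog ε⁻¹) / Real.log (Real.exp 1 + Real.posLog ε⁻¹)) := by
  -- a large odd `M`
  set a : ℝ := l₀ * Real.exp l₀ with ha
  have ha0 : 0 < a := by positivity
  obtain ⟨k, hk⟩ := exists_nat_gt (max a (2 * a * Real.exp l₀ / ε₀))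
  have hka : a < k := (le_max_left _ _).trans_lt hk
  have hkε : 2 * a * Real.exp l₀ / ε₀ < k := (le_max_right _ _).trans_lt hk
  have hk0 : (0 : ℝ) < k := ha0.trans hka
  set M : ℕ := 2 * k + 1 with hMdef
  have hMk : (k : ℝ) < M := by rw [hMdef]; push_cast; linarith
  have hM0 : (0 : ℝ) < M := hk0.trans hMk
  obtain ⟨μ, ν, iμ, iν, hμ, hν, ε, hε, hhi, hwin, hlow⟩ :=
    exists_cgf_close_means_far_sharp hl₀ (M := M) (odd_two_mul_add_one k)
  -- `ε ≤ ε₀`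
  have hb0 : 0 ≤ a / (2 * M) := div_nonneg ha0.le (by positivity)
  have hb1 : a / (2 * M) ≤ 1 := by
    rw [div_le_one (by positivity)]
    linarith
  have hεsmall : ε ≤ ε₀ := by
    have h1 : (a / (2 * M)) ^ M ≤ a / (2 * M) := by
      calc (a / (2 * M)) ^ M ≤ (a / (2 * M)) ^ 1 := pow_le_pow_of_le_one hb0 hb1 (by exact_mod_cast (odd_two_mul_add_one k).pos)
        _ = a / (2 * M) := pow_one _
    have h2 : ε ≤ 2 * a * Real.exp l₀ / M :=
      calc ε ≤ Real.exp l₀ * (4 * (a / (2 * M)) ^ M) := by rw [ha]; exact hhi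
        _ ≤ Real.exp l₀ * (4 * (a / (2 * M))) := by gcongr
        _ = 2 * a * Real.exp l₀ / M := by field_simp; ring
    have h3 : 2 * a * Real.exp l₀ / M ≤ 2 * a * Real.exp l₀ / k :=
      div_le_div_of_nonneg_left (mul_pos (mul_pos two_pos ha0) (Real.exp_pos _)).le hk0 hMk.le
    have h4 : 2 * a * Real.exp l₀ / k < ε₀ := by
      rw [div_lt_iff₀ hk0]
      have := (div_lt_iff₀ hε₀).1 hkε
      linarith
    linarith
  refine ⟨μ, ν, iμ, iν, hμ, hν, ε, hε, hεsmall, hwin, hlow, ?_⟩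
  -- the upper half: §2 with `X = Y = id`, `B = 1`
  have hup := abs_integral_sub_integral_le_sharp_of_cgf_close (μ := μ) (ν := ν) (X := id) (Y := id) (B := 1)
    aemeasurable_id aemeasurable_id (ae_abs_le_one_of_Icc hμ) (ae_abs_le_one_of_Icc hν) hl₀ hε.le hwin
  simp only [id, mul_one] at hup
  refine hup.trans (le_of_eq ?_)
  have hL0 : 0 ≤ Real.posLog ε⁻¹ := Real.posLog_nonneg
  have hlog : Real.log (Real.exp 1 + Real.posLog ε⁻¹) ≠ 0 := by
    have : 1 ≤ Real.log (Real.exp 1 + Real.posLog ε⁻¹) := by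
      rw [Real.le_log_iff_exp_le (add_pos_of_pos_of_nonneg (Real.exp_pos 1) hL0)]
      linarith
    linarith
  field_simp

end Sharp

end Summit.QuantumFields.YangMills.Theorems.BalabanUVNodesN19SharpPriceTwoSided

end
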